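import Mathlib
import Summits.AtomisticToContinuum.HydrodynamicLimit.Theorems.ImplosionDichotomyDenseExcursionPackingAnalyticSonicDampedTransport

/-!
# The damped transport max principle for COMPLEX amplitudes: a-priori bound along a ray of the teardrop
# (crux `DenseExcursion`, stmt-AtomisticToContinuum-12586, line `sonic-cavity-renewal` v8, stub `stub_analyticPackingImplosion`)

Helper file (`--supports stmt-AtomisticToContinuum-12586`, line lead a2, wave-4 worker D1, task (1)
`sonicWindow_analytic_bound`, second brick of the CORRECTED window plan — sup norms on a complex TEARDROP, worker report
`work/stubs/D1_gammaClosure.REPORT.md` §3). Restricted to a ray `t ↦ z_a + t(z − z_a)` of the teardrop (star-convex with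
respect to the real inflow point `z_a`; `hasDerivAt_linearODE_comp_path`, Literature `HolomorphicLinearODEStarConvex`), the
complexified regular characteristic `c₋M′ = (Λ − b₋₋)M − b₋₊P − F₋` of the order-`k` problem is the scalar equation
`m′(t) = −B(t) m(t) + F(t)` with COMPLEX `B` whose real part is the decay rate along the ray: measured on the pinned profile
(`work/stubs/numD1/teardrop.py`), `Re B ≥ 0.50·Λ·|z − z_a|` on every ray of the teardrops `conv({x_a} ∪ D(0, |x_a|/2))`,
`|x_a| ≤ 1/10` (decay along `Re` beats the complex growth `∝ Λ·Im²`). Kernel-checked here, the a-priori bound this feeds: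

* `complexDampedTransport_apriori_bound` (REGISTERED helper): `m′ = −Bm + F` on `[a, b]` with `Re B ≥ β₀ > 0`, `‖F‖ ≤ M`
  ⇒ `‖m(x)‖ ≤ ‖m(a)‖e^{−β₀(x−a)} + M/β₀` — the complex twin of `dampedTransport_apriori_bound` (gain `1/β₀ ≍ 1/Λ`, no
  `e^{cΛ}`): comparison of `‖m‖²` (derivative `2⟪m, m′⟫_ℝ = −2 Re B ‖m‖² + 2 Re(F m̄)`) with the strict supersolutions
  `(E + εe^{x−a})²`, `E = ‖m(a)‖e^{−β₀(x−a)} + (M/β₀)(1 − e^{−β₀(x−a)})`, then `ε → 0`.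

Pure one-variable calculus (`image_le_of_deriv_right_lt_deriv_boundary'`, `HasDerivAt.norm_sq`, `Complex.inner`).
NOT here: the teardrop geometry, the decay condition from the profile, the coupling to `P`, or `Γ`.
-/

noncomputable section

open Set Filter Topology

namespace Summit.AtomisticToContinuum.HydrodynamicLimit.Theorems.PackingAnalyticImplosion

-- adapted from `dampedTransport_apriori_bound` (…PackingAnalyticSonicDampedTransport): `m² ↦ ‖m‖²`, `βm² ↦ Re B ‖m‖²`
/-- **DAMPED TRANSPORT WITH COMPLEX AMPLITUDE, A PRIORI** (registered helper `complexDampedTransport_apriori_bound` of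
`stub_analyticPackingImplosion`): `m′ = −Bm + F`, `Re B ≥ β₀ > 0`, `‖F‖ ≤ M` on `[a, b]` ⇒
`‖m(x)‖ ≤ ‖m(a)‖e^{−β₀(x−a)} + M/β₀` on `[a, b]`. [folklore] -/
theorem complexDampedTransport_apriori_bound : ∀ (B F m : ℝ → ℂ) (a b β₀ M : ℝ), a ≤ b → 0 < β₀ → (∀ x ∈ Set.Icc a b, β₀ ≤ (B x).re) → (∀ x ∈ Set.Icc a b, ‖F x‖ ≤ M) → (∀ x ∈ Set.Icc a b, HasDerivAt m (-B x * m x + F x) x) → ∀ x ∈ Set.Icc a b, ‖m x‖ ≤ ‖m a‖ * Real.exp (-β₀ * (x - a)) + M / β₀ := by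
  intro B F m a b β₀ M hab hβ₀ hB hF hm x hx
  have hM : 0 ≤ M := (norm_nonneg _).trans (hF a (left_mem_Icc.2 hab))
  have hmc : ContinuousOn m (Icc a b) := fun y hy => (hm y hy).continuousAt.continuousWithinAt
  have hφc : ContinuousOn (fun y => ‖m y‖ ^ 2) (Icc a b) := (hmc.norm).pow 2
  -- the supersolution `E` and its strict perturbations `E + ε e^{x−a}`
  set E : ℝ → ℝ := fun y => ‖m a‖ * Real.exp (-β₀ * (y - a)) + M / β₀ * (1 - Real.exp (-β₀ * (y - a))) with hE
  have hEd : ∀ y, HasDerivAt E (-β₀ * E y + M) y := by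
    intro y
    have h1 : HasDerivAt (fun y => Real.exp (-β₀ * (y - a))) (Real.exp (-β₀ * (y - a)) * (-β₀)) y := by
      have hl : HasDerivAt (fun y : ℝ => -β₀ * (y - a)) (-β₀ * 1) y := ((hasDerivAt_id y).sub_const a).const_mul (-β₀)
      have h := (Real.hasDerivAt_exp (-β₀ * (y - a))).comp y hl
      exact h.congr_deriv (by ring)
    have h := (h1.const_mul ‖m a‖).add ((h1.const_sub 1).const_mul (M / β₀))
    refine h.congr_deriv ?_
    simp only [hE]
    field_simp
    ring
  have hEpos : ∀ y, a ≤ y → 0 ≤ E y := by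
    intro y hy
    have he : Real.exp (-β₀ * (y - a)) ≤ 1 := by
      rw [Real.exp_le_one_iff]; nlinarith
    have he0 : 0 < Real.exp (-β₀ * (y - a)) := Real.exp_pos _
    simp only [hE]
    have : 0 ≤ M / β₀ * (1 - Real.exp (-β₀ * (y - a))) := mul_nonneg (div_nonneg hM hβ₀.le) (by linarith)
    positivity
  -- the derivative of `‖m‖²`: `2⟪m, −Bm + F⟫_ℝ ≤ −2β₀‖m‖² + 2‖m‖M`
  have hφd : ∀ y ∈ Icc a b, HasDerivAt (fun y => ‖m y‖ ^ 2) (2 * inner ℝ (m y) (-B y * m y + F y)) y :=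
    fun y hy => (hm y hy).norm_sq
  have hinner : ∀ y ∈ Icc a b, inner ℝ (m y) (-B y * m y + F y) ≤ -β₀ * ‖m y‖ ^ 2 + ‖m y‖ * M := by
    intro y hy
    rw [Complex.inner, add_mul, Complex.add_re]
    have h1 : (-B y * m y * (starRingEnd ℂ) (m y)).re = -(B y).re * ‖m y‖ ^ 2 := by
      have e : m y * (starRingEnd ℂ) (m y) = ((‖m y‖ ^ 2 : ℝ) : ℂ) := by
        rw [Complex.mul_conj, Complex.normSq_eq_norm_sq]
      rw [mul_assoc, e]
      simp only [Complex.mul_re, Complex.ofReal_re, Complex.ofReal_im, mul_zero, sub_zero, Complex.neg_re]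
    have h2 : (F y * (starRingEnd ℂ) (m y)).re ≤ ‖m y‖ * M := by
      calc (F y * (starRingEnd ℂ) (m y)).re ≤ ‖F y * (starRingEnd ℂ) (m y)‖ := Complex.re_le_norm _
        _ = ‖F y‖ * ‖m y‖ := by rw [norm_mul, Complex.norm_conj]
        _ ≤ M * ‖m y‖ := mul_le_mul_of_nonneg_right (hF y hy) (norm_nonneg _)
        _ = ‖m y‖ * M := mul_comm _ _
    rw [h1]
    have h3 : -(B y).re * ‖m y‖ ^ 2 ≤ -β₀ * ‖m y‖ ^ 2 := by
      have := hB y hy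
      nlinarith [sq_nonneg ‖m y‖]
    linarith
  -- comparison of `‖m‖²` with `(E + ε e^{x−a})²` for every `ε > 0`
  have key : ∀ ε : ℝ, 0 < ε → ‖m x‖ ^ 2 ≤ (E x + ε * Real.exp (x - a)) ^ 2 := by
    intro ε hε
    set G : ℝ → ℝ := fun y => E y + ε * Real.exp (y - a) with hG
    have hGd : ∀ y, HasDerivAt G (-β₀ * E y + M + ε * Real.exp (y - a)) y := by
      intro y
      have h2 : HasDerivAt (fun y => ε * Real.exp (y - a)) (ε * Real.exp (y - a)) y := by
        have hl : HasDerivAt (fun y : ℝ => y - a) 1 y := (hasDerivAt_id y).sub_const a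
        have h := ((Real.hasDerivAt_exp (y - a)).comp y hl).const_mul ε
        exact h.congr_deriv (by ring)
      exact (hEd y).add h2
    have hGpos : ∀ y, a ≤ y → 0 < G y := fun y hy => by
      simp only [hG]; have := hEpos y hy; positivity
    have hcomp := image_le_of_deriv_right_lt_deriv_boundary' (f := fun y => ‖m y‖ ^ 2)
      (f' := fun y => 2 * inner ℝ (m y) (-B y * m y + F y)) (a := a) (b := b)
      hφc (fun y hy => ((hφd y (Ico_subset_Icc_self hy)).hasDerivWithinAt (s := Ici y)))
      (B := fun y => G y ^ 2) (B' := fun y => 2 * G y * (-β₀ * E y + M + ε * Real.exp (y - a)))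
      (by
        have hG0 : G a = ‖m a‖ + ε := by simp [hG, hE]
        show ‖m a‖ ^ 2 ≤ G a ^ 2
        rw [hG0]
        nlinarith [norm_nonneg (m a)])
      (fun y _ => ((hGd y).continuousAt.pow 2).continuousWithinAt)
      (fun y _ => by
        have h := ((hGd y).pow 2).hasDerivWithinAt (s := Ici y)
        exact h.congr_deriv (by norm_num))
      (fun y hy hyeq => by
        -- at a touching point `‖m‖² = G²`: `2⟪m, m′⟫ ≤ 2‖m‖(−β₀‖m‖ + M) < 2G·(−β₀E + M + εe^{y−a})`
        have hy' : a ≤ y := hy.1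
        have hGy := hGpos y hy'
        have habs : ‖m y‖ = G y := by
          have h2 : ‖m y‖ ^ 2 = G y ^ 2 := hyeq
          nlinarith [norm_nonneg (m y), sq_nonneg (‖m y‖ - G y), sq_nonneg (‖m y‖ + G y)]
        have hin := hinner y (Ico_subset_Icc_self hy)
        have hEG : E y ≤ G y := by simp only [hG]; have := Real.exp_pos (y - a); nlinarith
        have hexp := Real.exp_pos (y - a)
        show 2 * inner ℝ (m y) (-B y * m y + F y) < 2 * G y * (-β₀ * E y + M + ε * Real.exp (y - a))
        rw [habs] at hin
        nlinarith [hin, hGy, hexp, mul_pos hGy (mul_pos hε hexp), mul_nonneg hGy.le (sub_nonneg.2 hEG), hβ₀])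
    exact hcomp hx
  -- `ε → 0`
  have hlim : ‖m x‖ ^ 2 ≤ E x ^ 2 := by
    have ht : Tendsto (fun ε : ℝ => (E x + ε * Real.exp (x - a)) ^ 2) (𝓝[>] 0) (𝓝 ((E x + 0 * Real.exp (x - a)) ^ 2)) :=
      ((tendsto_const_nhds.add (tendsto_id.mul tendsto_const_nhds)).pow 2).mono_left nhdsWithin_le_nhds
    rw [zero_mul, add_zero] at ht
    exact ge_of_tendsto ht (eventually_nhdsWithin_of_forall fun ε hε => key ε hε)
  have hEx := hEpos x hx.1
  have habs : ‖m x‖ ≤ E x := by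
    nlinarith [norm_nonneg (m x), sq_nonneg (‖m x‖ - E x), hlim, hEx]
  calc ‖m x‖ ≤ E x := habs
    _ ≤ ‖m a‖ * Real.exp (-β₀ * (x - a)) + M / β₀ := by
        simp only [hE]
        have he0 : 0 < Real.exp (-β₀ * (x - a)) := Real.exp_pos _
        have : M / β₀ * (1 - Real.exp (-β₀ * (x - a))) ≤ M / β₀ := by
          have h1 : 0 ≤ M / β₀ := div_nonneg hM hβ₀.le
          nlinarith
        linarith

end Summit.AtomisticToContinuum.HydrodynamicLimit.Theorems.PackingAnalyticImplosion

end
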